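import Summits.QuantumFields.QCD.Theses.EulerDescent
import Summits.QuantumFields.QCD.Theorems.GapBuysCauchyRateLadderCauchyRateStubCalibratedFamily
import Summits.QuantumFields.QCD.Theorems.GapBuysCauchyRateLadderCauchyRateStubOnePointTranslation
import Summits.QuantumFields.QCD.Theorems.GapBuysCauchyRateLadderCauchyRateStubOnePointFlavour
import Summits.QuantumFields.QCD.Theorems.GapBuysCauchyRateLadderCauchyRateStubOnePointPseudoDiag
import Summits.QuantumFields.QCD.Theorems.GapBuysCauchyRateLadderCauchyRateStubSpeciesMultilinear
import HarnessLib

/-!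
# The pinned calibrated species family exists for EVERY regularisation
(helper of stub `stub_heavyCalibration`, line `vitali-mass-descent`, crux
`Summit.QuantumFields.QCD.Theses.EulerDescent.RetypedContinuumComplement`, item stmt-QuantumFields-16903)

What is proved, unconditionally and for every `reg : QCDRegularisation N_f`:

* `onePoint_law` — the ONE-POINT LAW of the honest periodic torus functional for ALL species: the
  one-point expectations `⟨O_s(x)⟩_{β, 2S+1, m}` are site-independent and real.  Site-independence is
  the landed `LadderCauchyRate.Birth.stub_onePointTranslation` (translation covariance); reality is
  `stub_onePointTranslation` for `glue` and VANISHING for the mesons: `pseudoRe f g`, `pseudoIm f g`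
  (`f ≠ g`) and `pseudoIm f f` by the flavour phases (`stub_onePointFlavour`), `pseudoRe f f` by the
  axis transposition (`stub_onePointPseudoDiag`).
* `exists_pinnedCalibratedFamily` — for every `τ₀ > 0`, every real `f₀ ≠ 0` supported in the slab
  `τ₀/2 ≤ x⁰ ≤ τ₀` and every positive default `ζ`, a `CalibratedSpeciesFamily reg` with `𝒞.τ₀ = τ₀`,
  `𝒞.f₀ = f₀`, the pinned counterterms `shift_s(m,k) = Re ⟨O_s(0)⟩_{k,m}` and the pinned multiplicative
  renormalisations: `z_s(m,k) = (Re C₁)^{-1/2}` on the branch where the bare connected calibrating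
  function `C₁ = ⟨Φ^s(Θf₀)Φ^s(f₀)⟩_conn` (`z ≡ 1`) is a positive real, `z_s(m,k) = ζ_s(m,k)` off it —
  the conclusion of the landed `stub_calibratedFamily`, whose two hypotheses (one-point law U, species
  multilinearity E1 = `stub_speciesMultilinear`) are now theorems.
* `exists_calibratedFamily` — the bare existence corollary.

Source of the construction: Montvay–Münster 1994, §1.7 (1.251)–(1.253) (wave-function
renormalisation condition on the two-point function) and §5.1 (composite meson fields, additive
renormalisation by the vacuum expectation value).  Def-free theorem file.
-/

noncomputable section

namespace Summit.QuantumFields.QCD.Cruxes.RetypedContinuumComplement.VitaliMassDescent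

open Literature.MathematicalPhysics.AQFT Literature.MathematicalPhysics.QuantumLattice
  Literature.MathematicalPhysics.QuantumFieldTheory
open Summit.QuantumFields.QCD.Cruxes.LadderCauchyRate.Birth
  (stub_calibratedFamily stub_onePointTranslation stub_onePointFlavour stub_onePointPseudoDiag
    stub_speciesMultilinear)

/-- **The one-point law of the periodic torus functional, all species.**  On every torus of odd side
`2S+1`, at every `β` and all bare masses, the one-point expectation of every species field is
site-independent and real (for the mesons it vanishes). [cite: MontvayMunster1994, §5.1] -/
theorem onePoint_law (Nf S : ℕ) (β : ℝ) (mq : Fin Nf → ℝ) (s : QCDField Nf)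
    (x : Literature.Probability.LatticeModels.Site 4) :
    qcdTorusExpect β (2 * S + 1) mq (fun U => insertion U s x) =
        qcdTorusExpect β (2 * S + 1) mq (fun U => insertion U s 0) ∧
      (qcdTorusExpect β (2 * S + 1) mq (fun U => insertion U s 0)).im = 0 := by
  obtain ⟨htr, hglue⟩ := stub_onePointTranslation Nf S β mq
  refine ⟨htr s x, ?_⟩
  cases s with
  | glue => exact hglue
  | pseudoRe f g =>
    by_cases hfg : f = g
    · subst hfg
      rw [stub_onePointPseudoDiag Nf S β mq f, Complex.zero_im]
    · rw [((stub_onePointFlavour Nf S β mq).1 f g hfg).1, Complex.zero_im]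
  | pseudoIm f g =>
    by_cases hfg : f = g
    · subst hfg
      rw [(stub_onePointFlavour Nf S β mq).2 f, Complex.zero_im]
    · rw [((stub_onePointFlavour Nf S β mq).1 f g hfg).2, Complex.zero_im]

/-- **The pinned calibrated species family exists for every regularisation.**  For every
`reg : QCDRegularisation N_f`, every calibration distance `τ₀ > 0`, every real reference function
`f₀ ≠ 0` supported in the time slab `τ₀/2 ≤ x⁰ ≤ τ₀` and every positive default `ζ`, there is a
calibrated species family `𝒞` over `reg` with `𝒞.τ₀ = τ₀`, `𝒞.f₀ = f₀`, the pinned additive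
counterterms `shift_s(m,k) = Re ⟨O_s(0)⟩_{k,m}` and the pinned multiplicative renormalisations
(`(Re C₁)^{-1/2}` on the positive-real branch of the bare connected calibrating function `C₁`, the
default `ζ` off it).  This is the landed `stub_calibratedFamily` with its hypotheses U (`onePoint_law`)
and E1 (`stub_speciesMultilinear`) discharged. [cite: MontvayMunster1994, §1.7 (1.251)–(1.253) and §5.1] -/
theorem exists_pinnedCalibratedFamily {Nf : ℕ} (reg : QCDRegularisation Nf) {τ₀ : ℝ} (hτ₀ : 0 < τ₀)
    {f₀ : SchwartzMap (EuclideanSpace ℝ (Fin 4)) ℝ} (hf₀ : f₀ ≠ 0)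
    (hsl : tsupport (f₀ : EuclideanSpace ℝ (Fin 4) → ℝ) ⊆ timeSlab 4 (τ₀ / 2) τ₀)
    (ζ : (Fin Nf → ℝ) → QCDField Nf → ℕ → ℝ) (hζ : ∀ m s k, 0 < ζ m s k) :
    ∃ 𝒞 : CalibratedSpeciesFamily reg, 𝒞.τ₀ = τ₀ ∧ 𝒞.f₀ = f₀ ∧
      (∀ (m : Fin Nf → ℝ) (s : QCDField Nf) (k : ℕ),
        𝒞.shift m s k =
          (qcdTorusExpect (reg.β k) (2 * reg.L k + 1) (fun fl => (reg.scheme m 0 0).mq fl k)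
            (fun U => insertion U s 0)).re) ∧
      (∀ (m : Fin Nf → ℝ) (s : QCDField Nf) (k : ℕ),
        ((0 < ((reg.scheme m (fun _ _ => (1 : ℝ)) (𝒞.shift m)).connectedTwoPoint k s s
              (thetaTest 4 𝒞.f₀) 𝒞.f₀).re ∧
            ((reg.scheme m (fun _ _ => (1 : ℝ)) (𝒞.shift m)).connectedTwoPoint k s s
              (thetaTest 4 𝒞.f₀) 𝒞.f₀).im = 0) →
          𝒞.z m s k =
            (Real.sqrt ((reg.scheme m (fun _ _ => (1 : ℝ)) (𝒞.shift m)).connectedTwoPoint k s s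
              (thetaTest 4 𝒞.f₀) 𝒞.f₀).re)⁻¹) ∧
        (¬ (0 < ((reg.scheme m (fun _ _ => (1 : ℝ)) (𝒞.shift m)).connectedTwoPoint k s s
              (thetaTest 4 𝒞.f₀) 𝒞.f₀).re ∧
            ((reg.scheme m (fun _ _ => (1 : ℝ)) (𝒞.shift m)).connectedTwoPoint k s s
              (thetaTest 4 𝒞.f₀) 𝒞.f₀).im = 0) →
          𝒞.z m s k = ζ m s k)) :=
  stub_calibratedFamily (fun Nf S β mq s x => onePoint_law Nf S β mq s x) stub_speciesMultilinear
    Nf reg τ₀ hτ₀ f₀ hf₀ hsl ζ hζ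

/-- **Every regularisation carries a calibrated species family** with prescribed calibration
distance and reference function (bare existence form of `exists_pinnedCalibratedFamily`, default
`ζ ≡ 1`). [cite: MontvayMunster1994, §1.7 (1.251)–(1.253) and §5.1] -/
theorem exists_calibratedFamily {Nf : ℕ} (reg : QCDRegularisation Nf) {τ₀ : ℝ} (hτ₀ : 0 < τ₀)
    {f₀ : SchwartzMap (EuclideanSpace ℝ (Fin 4)) ℝ} (hf₀ : f₀ ≠ 0)
    (hsl : tsupport (f₀ : EuclideanSpace ℝ (Fin 4) → ℝ) ⊆ timeSlab 4 (τ₀ / 2) τ₀) :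
    ∃ 𝒞 : CalibratedSpeciesFamily reg, 𝒞.τ₀ = τ₀ ∧ 𝒞.f₀ = f₀ := by
  obtain ⟨𝒞, h₁, h₂, -, -⟩ :=
    exists_pinnedCalibratedFamily reg hτ₀ hf₀ hsl (fun _ _ _ => 1) fun _ _ _ => one_pos
  exact ⟨𝒞, h₁, h₂⟩

end Summit.QuantumFields.QCD.Cruxes.RetypedContinuumComplement.VitaliMassDescent

end
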